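import Literature.Analysis.SpecialFunctions.GegenbauerHeatPositivity
import HarnessLib

/-!
# Higher jets of the ultraspherical polynomial heat flow

Sequel of `GegenbauerExplicitODE.lean` and `GegenbauerHeatPositivity.lean`.  For the explicit
Gegenbauer sums `C_n^{(a)}` we add the term-wise third and fourth derivative sums
`gegenbauerSumDDD`, `gegenbauerSumDDDD` (`DD' = DDD`, `DDD' = DDDD`) and the two differentiated
forms of the ultraspherical equation `(1-s²)C'' - (2a+1)sC' + n(n+2a)C = 0`:

* `gegenbauerSum_ode_deriv`  — `(1-s²)C''' - (2a+3)sC'' + (n(n+2a) - (2a+1))C' = 0`;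
* `gegenbauerSum_ode_deriv2` — `(1-s²)C'''' - (2a+5)sC''' + (n(n+2a) - (4a+4))C'' = 0`

(the derivative of an identically vanishing differentiable function vanishes).  For the polynomial
heat flow `V = gegenbauerHeat k b J` (`a = k + 1/2`, `∂_τ V = (1-s²)∂²_s V - (2k+2)s∂_s V`) this gives
the jets `gegenbauerHeatDsss`, `gegenbauerHeatDssss` (`∂³_s V`, `∂⁴_s V`) and the time derivatives
of the first two space derivatives,

* `hasDerivAt_gegenbauerHeatDs_t`  — `∂_τ ∂_s V = (1-s²)∂³_s V - (2k+4)s ∂²_s V - (2k+2) ∂_s V`;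
* `hasDerivAt_gegenbauerHeatDss_t` — `∂_τ ∂²_s V = (1-s²)∂⁴_s V - (2k+6)s ∂³_s V - (4k+6) ∂²_s V`,

which are the input of the Li–Yau–Hamilton maximum-principle computation for `log V`
(`GegenbauerHeatHarnack.lean`).  Everything is proved; no named facts.

## References
* G. E. Andrews, R. Askey, R. Roy, *Special Functions*, CUP 1999, §6.4.
* R. S. Hamilton, *A matrix Harnack estimate for the heat equation*, Comm. Anal. Geom. 1 (1993)
  113–126.
-/

noncomputable section

open scoped BigOperators Nat
open Finset

namespace Literature.Analysis.SpecialFunctions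

/-! ### Third and fourth term-wise derivatives of the explicit sums -/

/-- The term-wise third derivative of `C_n^{(a)}`. [folklore] -/
def gegenbauerSumDDD (a : ℝ) (n : ℕ) (s : ℝ) : ℝ :=
  ∑ l ∈ Finset.range (n / 2 + 1),
    gegenbauerCoeff a n l * (((n - 2 * l : ℕ) : ℝ) * (((n - 2 * l - 1 : ℕ) : ℝ) *
      (((n - 2 * l - 1 - 1 : ℕ) : ℝ) * (2 * s) ^ (n - 2 * l - 1 - 1 - 1) * 2) * 2) * 2)

/-- The term-wise fourth derivative of `C_n^{(a)}`. [folklore] -/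
def gegenbauerSumDDDD (a : ℝ) (n : ℕ) (s : ℝ) : ℝ :=
  ∑ l ∈ Finset.range (n / 2 + 1),
    gegenbauerCoeff a n l * (((n - 2 * l : ℕ) : ℝ) * (((n - 2 * l - 1 : ℕ) : ℝ) *
      (((n - 2 * l - 1 - 1 : ℕ) : ℝ) * (((n - 2 * l - 1 - 1 - 1 : ℕ) : ℝ) *
        (2 * s) ^ (n - 2 * l - 1 - 1 - 1 - 1) * 2) * 2) * 2) * 2)

/-- `d/ds DD_n^{(a)} = DDD_n^{(a)}`. [folklore] -/
theorem hasDerivAt_gegenbauerSumDD (a : ℝ) (n : ℕ) (s : ℝ) :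
    HasDerivAt (gegenbauerSumDD a n) (gegenbauerSumDDD a n s) s := by
  have h2s : HasDerivAt (fun x : ℝ => 2 * x) 2 s := by
    simpa using (hasDerivAt_id s).const_mul (2 : ℝ)
  unfold gegenbauerSumDD gegenbauerSumDDD
  refine HasDerivAt.fun_sum fun l _ => ?_
  have h := ((((h2s.fun_pow (n - 2 * l - 1 - 1)).const_mul (((n - 2 * l - 1 : ℕ) : ℝ))).mul_const
    (2 : ℝ)).const_mul (((n - 2 * l : ℕ) : ℝ))).mul_const (2 : ℝ)
  exact (h.const_mul (gegenbauerCoeff a n l)).congr_deriv (by ring)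

/-- `d/ds DDD_n^{(a)} = DDDD_n^{(a)}`. [folklore] -/
theorem hasDerivAt_gegenbauerSumDDD (a : ℝ) (n : ℕ) (s : ℝ) :
    HasDerivAt (gegenbauerSumDDD a n) (gegenbauerSumDDDD a n s) s := by
  have h2s : HasDerivAt (fun x : ℝ => 2 * x) 2 s := by
    simpa using (hasDerivAt_id s).const_mul (2 : ℝ)
  unfold gegenbauerSumDDD gegenbauerSumDDDD
  refine HasDerivAt.fun_sum fun l _ => ?_
  have h := ((((((h2s.fun_pow (n - 2 * l - 1 - 1 - 1)).const_mul
    (((n - 2 * l - 1 - 1 : ℕ) : ℝ))).mul_const (2 : ℝ)).const_mul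
    (((n - 2 * l - 1 : ℕ) : ℝ))).mul_const (2 : ℝ)).const_mul (((n - 2 * l : ℕ) : ℝ))).mul_const (2 : ℝ)
  exact (h.const_mul (gegenbauerCoeff a n l)).congr_deriv (by ring)

/-- `DDD_n^{(a)}` is continuous. [folklore] -/
theorem continuous_gegenbauerSumDDD (a : ℝ) (n : ℕ) : Continuous (gegenbauerSumDDD a n) := by
  unfold gegenbauerSumDDD; fun_prop

/-- `DDDD_n^{(a)}` is continuous. [folklore] -/
theorem continuous_gegenbauerSumDDDD (a : ℝ) (n : ℕ) : Continuous (gegenbauerSumDDDD a n) := by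
  unfold gegenbauerSumDDDD; fun_prop

/-! ### The differentiated ultraspherical equations -/

/-- If a function vanishes identically, so does any derivative of it. [folklore] -/
theorem hasDerivAt_zero_unique {g : ℝ → ℝ} {e s : ℝ} (hg : ∀ x, g x = 0) (h : HasDerivAt g e s) :
    e = 0 := by
  have h0 : g = fun _ => (0 : ℝ) := funext hg
  rw [h0] at h
  exact h.unique (hasDerivAt_const s 0) ▸ rfl

/-- **First differentiated ultraspherical equation**:
`(1-s²) C''' - (2a+3) s C'' + (n(n+2a) - (2a+1)) C' = 0`.
[cite: AndrewsAskeyRoy1999, §6.4 (ultraspherical differential equation)] -/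
theorem gegenbauerSum_ode_deriv (a : ℝ) (n : ℕ) (s : ℝ) :
    (1 - s ^ 2) * gegenbauerSumDDD a n s - (2 * a + 3) * s * gegenbauerSumDD a n s +
      ((n : ℝ) * ((n : ℝ) + 2 * a) - (2 * a + 1)) * gegenbauerSumD a n s = 0 := by
  have hD : HasDerivAt (fun x => (1 - x ^ 2) * gegenbauerSumDD a n x - (2 * a + 1) * x *
      gegenbauerSumD a n x + (n : ℝ) * ((n : ℝ) + 2 * a) * gegenbauerSum a n x)
      ((-(2 * s)) * gegenbauerSumDD a n s + (1 - s ^ 2) * gegenbauerSumDDD a n s -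
        ((2 * a + 1) * 1 * gegenbauerSumD a n s + (2 * a + 1) * s * gegenbauerSumDD a n s) +
        (n : ℝ) * ((n : ℝ) + 2 * a) * gegenbauerSumD a n s) s := by
    have h1 : HasDerivAt (fun x : ℝ => 1 - x ^ 2) (-(2 * s)) s := by
      simpa using (hasDerivAt_pow 2 s).const_sub 1
    have h2 : HasDerivAt (fun x : ℝ => (2 * a + 1) * x) ((2 * a + 1) * 1) s :=
      (hasDerivAt_id s).const_mul _
    exact ((h1.mul (hasDerivAt_gegenbauerSumDD a n s)).sub
      (h2.mul (hasDerivAt_gegenbauerSumD a n s))).add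
      ((hasDerivAt_gegenbauerSum a n s).const_mul _)
  have h0 := hasDerivAt_zero_unique (fun x => gegenbauerSum_ode a n x) hD
  linear_combination h0

/-- **Second differentiated ultraspherical equation**:
`(1-s²) C'''' - (2a+5) s C''' + (n(n+2a) - (4a+4)) C'' = 0`.
[cite: AndrewsAskeyRoy1999, §6.4 (ultraspherical differential equation)] -/
theorem gegenbauerSum_ode_deriv2 (a : ℝ) (n : ℕ) (s : ℝ) :
    (1 - s ^ 2) * gegenbauerSumDDDD a n s - (2 * a + 5) * s * gegenbauerSumDDD a n s +
      ((n : ℝ) * ((n : ℝ) + 2 * a) - (4 * a + 4)) * gegenbauerSumDD a n s = 0 := by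
  have hD : HasDerivAt (fun x => (1 - x ^ 2) * gegenbauerSumDDD a n x - (2 * a + 3) * x *
      gegenbauerSumDD a n x + ((n : ℝ) * ((n : ℝ) + 2 * a) - (2 * a + 1)) * gegenbauerSumD a n x)
      ((-(2 * s)) * gegenbauerSumDDD a n s + (1 - s ^ 2) * gegenbauerSumDDDD a n s -
        ((2 * a + 3) * 1 * gegenbauerSumDD a n s + (2 * a + 3) * s * gegenbauerSumDDD a n s) +
        ((n : ℝ) * ((n : ℝ) + 2 * a) - (2 * a + 1)) * gegenbauerSumDD a n s) s := by
    have h1 : HasDerivAt (fun x : ℝ => 1 - x ^ 2) (-(2 * s)) s := by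
      simpa using (hasDerivAt_pow 2 s).const_sub 1
    have h2 : HasDerivAt (fun x : ℝ => (2 * a + 3) * x) ((2 * a + 3) * 1) s :=
      (hasDerivAt_id s).const_mul _
    exact ((h1.mul (hasDerivAt_gegenbauerSumDDD a n s)).sub
      (h2.mul (hasDerivAt_gegenbauerSumDD a n s))).add
      ((hasDerivAt_gegenbauerSumD a n s).const_mul _)
  have h0 := hasDerivAt_zero_unique (fun x => gegenbauerSum_ode_deriv a n x) hD
  linear_combination h0

/-! ### Higher jets of the polynomial heat flow -/

/-- `∂³_s V`. [folklore] -/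
def gegenbauerHeatDsss (k : ℕ) (b : ℕ → ℝ) (J : ℕ) (s τ : ℝ) : ℝ :=
  ∑ j ∈ Finset.range J, b j * Real.exp (-((j : ℝ) * ((j : ℝ) + 2 * k + 1) * τ)) *
    gegenbauerSumDDD ((k : ℝ) + 1 / 2) j s

/-- `∂⁴_s V`. [folklore] -/
def gegenbauerHeatDssss (k : ℕ) (b : ℕ → ℝ) (J : ℕ) (s τ : ℝ) : ℝ :=
  ∑ j ∈ Finset.range J, b j * Real.exp (-((j : ℝ) * ((j : ℝ) + 2 * k + 1) * τ)) *
    gegenbauerSumDDDD ((k : ℝ) + 1 / 2) j s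

section Flow

variable (k : ℕ) (b : ℕ → ℝ) (J : ℕ)

/-- `∂³_s V` is the `s`-derivative of `∂²_s V`. [folklore] -/
theorem hasDerivAt_gegenbauerHeatDss_s (s τ : ℝ) :
    HasDerivAt (fun x => gegenbauerHeatDss k b J x τ) (gegenbauerHeatDsss k b J s τ) s := by
  unfold gegenbauerHeatDss gegenbauerHeatDsss
  refine HasDerivAt.fun_sum fun j _ => ?_
  exact (hasDerivAt_gegenbauerSumDD _ j s).const_mul _

/-- `∂⁴_s V` is the `s`-derivative of `∂³_s V`. [folklore] -/
theorem hasDerivAt_gegenbauerHeatDsss_s (s τ : ℝ) :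
    HasDerivAt (fun x => gegenbauerHeatDsss k b J x τ) (gegenbauerHeatDssss k b J s τ) s := by
  unfold gegenbauerHeatDsss gegenbauerHeatDssss
  refine HasDerivAt.fun_sum fun j _ => ?_
  exact (hasDerivAt_gegenbauerSumDDD _ j s).const_mul _

/-- The time derivative of the weight `b_j e^{-j(j+2k+1)τ}`. [folklore] -/
theorem hasDerivAt_heatWeight (j : ℕ) (τ : ℝ) :
    HasDerivAt (fun t : ℝ => b j * Real.exp (-((j : ℝ) * ((j : ℝ) + 2 * k + 1) * t)))
      (-((j : ℝ) * ((j : ℝ) + 2 * k + 1)) *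
        (b j * Real.exp (-((j : ℝ) * ((j : ℝ) + 2 * k + 1) * τ)))) τ := by
  have h1 : HasDerivAt (fun t : ℝ => -((j : ℝ) * ((j : ℝ) + 2 * k + 1) * t))
      (-((j : ℝ) * ((j : ℝ) + 2 * k + 1))) τ :=
    (((hasDerivAt_id τ).const_mul ((j : ℝ) * ((j : ℝ) + 2 * k + 1))).neg).congr_deriv (by simp)
  exact (h1.exp.const_mul (b j)).congr_deriv (by ring)

/-- **`∂_τ ∂_s V = (1-s²) ∂³_s V - (2k+4) s ∂²_s V - (2k+2) ∂_s V`** (term-wise the first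
differentiated ultraspherical equation). [folklore] -/
theorem hasDerivAt_gegenbauerHeatDs_t (s τ : ℝ) :
    HasDerivAt (fun t => gegenbauerHeatDs k b J s t)
      ((1 - s ^ 2) * gegenbauerHeatDsss k b J s τ - (2 * k + 4) * s * gegenbauerHeatDss k b J s τ -
        (2 * k + 2) * gegenbauerHeatDs k b J s τ) τ := by
  have hsum : HasDerivAt (fun t => gegenbauerHeatDs k b J s t)
      (∑ j ∈ Finset.range J, -((j : ℝ) * ((j : ℝ) + 2 * k + 1)) *
        (b j * Real.exp (-((j : ℝ) * ((j : ℝ) + 2 * k + 1) * τ))) *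
          gegenbauerSumD ((k : ℝ) + 1 / 2) j s) τ := by
    unfold gegenbauerHeatDs
    refine HasDerivAt.fun_sum fun j _ => ?_
    exact (hasDerivAt_heatWeight k b j τ).mul_const _
  refine hsum.congr_deriv ?_
  unfold gegenbauerHeatDsss gegenbauerHeatDss gegenbauerHeatDs
  rw [Finset.mul_sum, Finset.mul_sum, Finset.mul_sum, ← Finset.sum_sub_distrib,
    ← Finset.sum_sub_distrib]
  refine Finset.sum_congr rfl fun j _ => ?_
  have hode := gegenbauerSum_ode_deriv ((k : ℝ) + 1 / 2) j s
  linear_combination (-(b j * Real.exp (-((j : ℝ) * ((j : ℝ) + 2 * k + 1) * τ)))) * hode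

/-- **`∂_τ ∂²_s V = (1-s²) ∂⁴_s V - (2k+6) s ∂³_s V - (4k+6) ∂²_s V`** (term-wise the second
differentiated ultraspherical equation). [folklore] -/
theorem hasDerivAt_gegenbauerHeatDss_t (s τ : ℝ) :
    HasDerivAt (fun t => gegenbauerHeatDss k b J s t)
      ((1 - s ^ 2) * gegenbauerHeatDssss k b J s τ - (2 * k + 6) * s * gegenbauerHeatDsss k b J s τ -
        (4 * k + 6) * gegenbauerHeatDss k b J s τ) τ := by
  have hsum : HasDerivAt (fun t => gegenbauerHeatDss k b J s t)
      (∑ j ∈ Finset.range J, -((j : ℝ) * ((j : ℝ) + 2 * k + 1)) *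
        (b j * Real.exp (-((j : ℝ) * ((j : ℝ) + 2 * k + 1) * τ))) *
          gegenbauerSumDD ((k : ℝ) + 1 / 2) j s) τ := by
    unfold gegenbauerHeatDss
    refine HasDerivAt.fun_sum fun j _ => ?_
    exact (hasDerivAt_heatWeight k b j τ).mul_const _
  refine hsum.congr_deriv ?_
  unfold gegenbauerHeatDssss gegenbauerHeatDsss gegenbauerHeatDss
  rw [Finset.mul_sum, Finset.mul_sum, Finset.mul_sum, ← Finset.sum_sub_distrib,
    ← Finset.sum_sub_distrib]
  refine Finset.sum_congr rfl fun j _ => ?_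
  have hode := gegenbauerSum_ode_deriv2 ((k : ℝ) + 1 / 2) j s
  linear_combination (-(b j * Real.exp (-((j : ℝ) * ((j : ℝ) + 2 * k + 1) * τ)))) * hode

/-- The heat equation as a `HasDerivAt` statement:
`∂_τ V = (1-s²) ∂²_s V - (2k+2) s ∂_s V`. [folklore] -/
theorem hasDerivAt_gegenbauerHeat_t_pde (s τ : ℝ) :
    HasDerivAt (fun t => gegenbauerHeat k b J s t)
      ((1 - s ^ 2) * gegenbauerHeatDss k b J s τ - (2 * k + 2) * s * gegenbauerHeatDs k b J s τ) τ := by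
  rw [← gegenbauerHeat_pde]
  exact hasDerivAt_gegenbauerHeat_t k b J s τ

end Flow

end Literature.Analysis.SpecialFunctions
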